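import Mathlib
import Literature.Analysis.FluidPDE.SteadyNSLatticePersistence
import Literature.Analysis.FluidPDE.TorusABCFlow
import Summits.NavierStokesRegularity.FluidComputer.ShellCouplingSupport
import HarnessLib

/-!
# Spherical-shell adjacency of the ABC linearisation: D2-CHAIN-MAP step S3 for the cap2 ladder certificates (cap2 g2, cell `ns-blowup`, 2026-08-26)

HONEST FRAMING (human ruling D-0035): nothing here is a claim about Navier–Stokes blow-up.
WHAT THIS IS NOT: not NS evidence. MODEL/linear bookkeeping. The THEOREM 3-L certificates of the
cap2 ladder (`HOME/cap2/d2s_cert.py` 526db1ca2d823856; R 300 classes I/II, R 500 class II,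
STATUS l.2586 / l.2844 / l.3947) order the Galerkin degrees of freedom by SPHERICAL shells
`S_s = {k ∈ ℤ³ : s² ≤ |k|² < (s+1)²}` (`SphShell`, l.289; `s = floor |k|`) instead of cap's cube shells
`|k|_∞ = s`, and use — as the cube certificates do — that the linearisation
`T = ℙ[(U·∇)· + (·∇)U]`, `U = abc(1,1,1)`, couples shell `s` to shells `s − 1, s, s + 1` ONLY
(block-tridiagonal head, one cross block `K ↔ K + 1`; docstring l.5 «`| |k ± eᵢ| − |k| | ≤ 1`»,
checked in-job by a structural `assert`). `CubeShellAdjacency` (p433046) and `ShellCouplingSupport`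
(p435584) prove this for cube shells from the WEAK support fact `Û(m) = 0` unless `|m|_∞ ≤ 1`; for
spherical shells that fact is not enough (`m = (1,1,1)` would jump two shells) and the EXACT support
`{±e₀, ±e₁, ±e₂}` of the ABC field (`Torus.mFourierCoeff_abcFlow`, `Torus.freqNormSq_abcDir`) is
what makes it true. This file proves, over `k : d → ℤ` with `|k|²` written as `∑ᵢ kᵢ²` (no new
definitions):

* `abs_sum_mul_le_of_unit` — `∑ qᵢ² ≤ 1`, `∑ kᵢ² < (s+1)²` ⇒ `|∑ kᵢqᵢ| ≤ s` (integer Cauchy–Schwarz);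
* `sum_sq_add_lt_of_unit` / `sq_le_sum_sq_add_of_unit` / `sph_window_of_unit` (+ `_sub`) — for
  `∑ qᵢ² ≤ 1` and `k` on the spherical shell `s ≥ 1`: `(s−1)² ≤ |k ± q|² < (s+2)²`, i.e. `k ± q`
  lies on shell `s − 1`, `s` or `s + 1`;
* `transportSym_eq_zero_of_sph_host` / `transportSym_eq_zero_of_sph_coeff` — lattice transport /
  stretching symbols with one factor supported in `{∑ qᵢ² ≤ 1}` and the other on shell `s` vanish
  outside the three-shell window;
* `sum_sq_abcDir`, `mFourierCoeff_abcFlow_eq_zero_of_sum_sq` — the tree's ABC object is supported in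
  `{∑ mᵢ² ≤ 1}` (indeed `= 1`);
* `mFourierCoeff_convect_abcFlow_sph_eq_zero` / `…'` — for a smooth real `w` on `𝕋³` whose Fourier
  coefficients vanish off the spherical shell `s ≥ 1`, the coefficients of `(U·∇)w` and of `(w·∇)U`
  (`U = Torus.abcFlow A B C`) vanish at every `k` outside `{(s−1)² ≤ |k|² < (s+2)²}`.

Mathlib + the tree's Fourier dictionary (`SteadyLattice.mFourierCoeff_convect_real`) + `TorusABCFlow`
+ `ShellCouplingSupport` (the two `…_of_forall` vanishing lemmas); no new definitions.
-/

noncomputable section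

namespace Summit.NavierStokesRegularity.FluidComputer.SphShellAdjacency

open Literature.Analysis.FluidPDE Literature.Analysis.FluidPDE.ScalarFourier
open Literature.Analysis.FluidPDE.SteadyLattice
open Literature.Analysis.FunctionSpaces Literature.Analysis.FunctionSpaces.Torus
open Literature.Analysis.FunctionSpaces.EuclideanSpace UnitAddTorus
open Summit.NavierStokesRegularity.FluidComputer.ShellCouplingSupport

/-! ## Lattice level -/

section Lattice

variable {d : Type*} [Fintype d]

/-- Expansion of `|k + q|²` coordinatewise: `∑ (kᵢ + qᵢ)² = ∑ kᵢ² + 2∑ kᵢqᵢ + ∑ qᵢ²`. -/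
theorem sum_sq_add_eq (k q : d → ℤ) :
    ∑ i, (k + q) i ^ 2 = ∑ i, k i ^ 2 + 2 * ∑ i, k i * q i + ∑ i, q i ^ 2 := by
  simp only [Pi.add_apply, add_sq, Finset.sum_add_distrib, Finset.mul_sum]
  ring_nf

/-- **Integer Cauchy–Schwarz against a unit step.** If `∑ qᵢ² ≤ 1` and `∑ kᵢ² < (s+1)²` with
`0 ≤ s`, then `|∑ kᵢqᵢ| ≤ s`. -/
theorem abs_sum_mul_le_of_unit {k q : d → ℤ} {s : ℤ} (hs : 0 ≤ s) (hq : ∑ i, q i ^ 2 ≤ 1)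
    (hk : ∑ i, k i ^ 2 < (s + 1) ^ 2) : |∑ i, k i * q i| ≤ s := by
  have hcs := Finset.sum_mul_sq_le_sq_mul_sq Finset.univ k q
  have hk0 : 0 ≤ ∑ i, k i ^ 2 := Finset.sum_nonneg fun i _ => sq_nonneg (k i)
  have h1 : (∑ i, k i * q i) ^ 2 ≤ ∑ i, k i ^ 2 := by
    calc (∑ i, k i * q i) ^ 2 ≤ (∑ i, k i ^ 2) * ∑ i, q i ^ 2 := hcs
      _ ≤ (∑ i, k i ^ 2) * 1 := mul_le_mul_of_nonneg_left hq hk0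
      _ = ∑ i, k i ^ 2 := mul_one _
  have h2 : (∑ i, k i * q i) ^ 2 < (s + 1) ^ 2 := h1.trans_lt hk
  have h3 : |∑ i, k i * q i| < s + 1 := abs_lt_of_sq_lt_sq h2 (by linarith)
  omega

/-- **Upper adjacency.** `∑ qᵢ² ≤ 1`, `∑ kᵢ² < (s+1)²`, `0 ≤ s` ⇒ `∑ (kᵢ+qᵢ)² < (s+2)²`: a unit step
raises the spherical shell by at most one. -/
theorem sum_sq_add_lt_of_unit {k q : d → ℤ} {s : ℤ} (hs : 0 ≤ s) (hq : ∑ i, q i ^ 2 ≤ 1)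
    (hk : ∑ i, k i ^ 2 < (s + 1) ^ 2) : ∑ i, (k + q) i ^ 2 < (s + 2) ^ 2 := by
  have h := abs_sum_mul_le_of_unit hs hq hk
  have h' := (abs_le.mp h).2
  rw [sum_sq_add_eq]
  nlinarith

/-- **Lower adjacency.** `∑ qᵢ² ≤ 1`, `s² ≤ ∑ kᵢ² < (s+1)²`, `1 ≤ s` ⇒ `(s−1)² ≤ ∑ (kᵢ+qᵢ)²`: a unit
step lowers the spherical shell by at most one. -/
theorem sq_le_sum_sq_add_of_unit {k q : d → ℤ} {s : ℤ} (hs : 1 ≤ s) (hq : ∑ i, q i ^ 2 ≤ 1)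
    (hk : s ^ 2 ≤ ∑ i, k i ^ 2) (hk' : ∑ i, k i ^ 2 < (s + 1) ^ 2) :
    (s - 1) ^ 2 ≤ ∑ i, (k + q) i ^ 2 := by
  have h := abs_sum_mul_le_of_unit (by linarith) hq hk'
  have h' := (abs_le.mp h).1
  have hq0 : 0 ≤ ∑ i, q i ^ 2 := Finset.sum_nonneg fun i _ => sq_nonneg (q i)
  rw [sum_sq_add_eq]
  rcases (Int.lt_or_le (∑ i, q i ^ 2) 1) with hlt | hge
  · -- `∑ qᵢ² = 0`: `q = 0`, so the cross term vanishes
    have hz : ∑ i, q i ^ 2 = 0 := le_antisymm (by omega) hq0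
    have hqi : ∀ i, q i = 0 := by
      intro i
      have := (Finset.sum_eq_zero_iff_of_nonneg (fun j _ => sq_nonneg (q j))).mp hz i (Finset.mem_univ i)
      exact pow_eq_zero_iff (n := 2) (by norm_num) |>.mp this
    have hcross : ∑ i, k i * q i = 0 := Finset.sum_eq_zero fun i _ => by rw [hqi i, mul_zero]
    rw [hcross, hz]
    nlinarith
  · have h1 : ∑ i, q i ^ 2 = 1 := le_antisymm hq hge
    rw [h1]
    nlinarith

/-- **The three-shell window.** With `∑ qᵢ² ≤ 1` and `k` on the spherical shell `s ≥ 1`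
(`s² ≤ ∑ kᵢ² < (s+1)²`), `k + q` lies in the window `(s−1)² ≤ ∑ (kᵢ+qᵢ)² < (s+2)²` — shells
`s − 1`, `s`, `s + 1`: the adjacency sentence of D2-CHAIN-MAP step S3 for spherical shells
(block-tridiagonal head in the shell ordering of `d2s_cert.py`). -/
theorem sph_window_of_unit {k q : d → ℤ} {s : ℤ} (hs : 1 ≤ s) (hq : ∑ i, q i ^ 2 ≤ 1)
    (hk : s ^ 2 ≤ ∑ i, k i ^ 2 ∧ ∑ i, k i ^ 2 < (s + 1) ^ 2) :
    (s - 1) ^ 2 ≤ ∑ i, (k + q) i ^ 2 ∧ ∑ i, (k + q) i ^ 2 < (s + 2) ^ 2 :=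
  ⟨sq_le_sum_sq_add_of_unit hs hq hk.1 hk.2, sum_sq_add_lt_of_unit (by linarith) hq hk.2⟩

/-- The same window for `k − q` (the coupling `k → k − e`), since `(−qᵢ)² = qᵢ²`. -/
theorem sph_window_sub_of_unit {k q : d → ℤ} {s : ℤ} (hs : 1 ≤ s) (hq : ∑ i, q i ^ 2 ≤ 1)
    (hk : s ^ 2 ≤ ∑ i, k i ^ 2 ∧ ∑ i, k i ^ 2 < (s + 1) ^ 2) :
    (s - 1) ^ 2 ≤ ∑ i, (k - q) i ^ 2 ∧ ∑ i, (k - q) i ^ 2 < (s + 2) ^ 2 := by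
  have hq' : ∑ i, (-q) i ^ 2 ≤ 1 := by simpa using hq
  simpa [sub_eq_add_neg] using sph_window_of_unit (q := -q) hs hq' hk

/-- **Transport by a unit-sphere host is nearest-neighbour in the spherical shells.** If the host
symbol `U j` vanishes off `{∑ qᵢ² ≤ 1}` and the coefficient family `c` vanishes off the spherical shell
`s ≥ 1`, then `transportSym U c k = 0` at every `k` outside `{(s−1)² ≤ ∑ kᵢ² < (s+2)²}` — the symbol
of `(U·∇)w`. -/
theorem transportSym_eq_zero_of_sph_host {U : d → (d → ℤ) → ℂ} {c : (d → ℤ) → ℂ} {s : ℤ}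
    (hs : 1 ≤ s) (hU : ∀ j q, (¬ ∑ i, q i ^ 2 ≤ 1) → U j q = 0)
    (hc : ∀ m, (¬ (s ^ 2 ≤ ∑ i, m i ^ 2 ∧ ∑ i, m i ^ 2 < (s + 1) ^ 2)) → c m = 0)
    {k : d → ℤ} (hk : ¬ ((s - 1) ^ 2 ≤ ∑ i, k i ^ 2 ∧ ∑ i, k i ^ 2 < (s + 2) ^ 2)) :
    transportSym U c k = 0 := by
  refine transportSym_eq_zero_of_forall fun j q => ?_
  by_cases hq : ∑ i, q i ^ 2 ≤ 1
  · by_cases hm : s ^ 2 ≤ ∑ i, (k - q) i ^ 2 ∧ ∑ i, (k - q) i ^ 2 < (s + 1) ^ 2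
    · exfalso; apply hk
      have hw := sph_window_of_unit (k := k - q) (q := q) hs hq hm
      rwa [sub_add_cancel] at hw
    · exact Or.inr (hc _ hm)
  · exact Or.inl (hU j q hq)

/-- **Stretching of a unit-sphere host is nearest-neighbour in the spherical shells.** If the
transporting family `W j` vanishes off the spherical shell `s ≥ 1` and the transported coefficients
`u` vanish off `{∑ qᵢ² ≤ 1}`, then `transportSym W u k = 0` outside the same window — the symbol
of `(w·∇)U`. -/
theorem transportSym_eq_zero_of_sph_coeff {W : d → (d → ℤ) → ℂ} {u : (d → ℤ) → ℂ} {s : ℤ}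
    (hs : 1 ≤ s) (hW : ∀ j m, (¬ (s ^ 2 ≤ ∑ i, m i ^ 2 ∧ ∑ i, m i ^ 2 < (s + 1) ^ 2)) → W j m = 0)
    (hu : ∀ q, (¬ ∑ i, q i ^ 2 ≤ 1) → u q = 0)
    {k : d → ℤ} (hk : ¬ ((s - 1) ^ 2 ≤ ∑ i, k i ^ 2 ∧ ∑ i, k i ^ 2 < (s + 2) ^ 2)) :
    transportSym W u k = 0 := by
  refine transportSym_eq_zero_of_forall fun j m => ?_
  by_cases hm : s ^ 2 ≤ ∑ i, m i ^ 2 ∧ ∑ i, m i ^ 2 < (s + 1) ^ 2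
  · by_cases hq : ∑ i, (k - m) i ^ 2 ≤ 1
    · exfalso; apply hk
      have hw := sph_window_of_unit (k := m) (q := k - m) hs hq hm
      rwa [add_sub_cancel] at hw
    · exact Or.inr (hu _ hq)
  · exact Or.inl (hW j m hm)

end Lattice

/-! ## The ABC host on the unit torus -/

/-- The ABC directions are unit lattice vectors: `∑ᵢ (abcDir y)ᵢ² = 1` (integer form of
`Torus.freqNormSq_abcDir`). -/
theorem sum_sq_abcDir (y : Fin 3 × Bool) : ∑ i, Torus.abcDir y i ^ 2 = 1 := by
  have h := Torus.freqNormSq_abcDir y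
  rw [freqNormSq] at h
  have e : ((∑ i, Torus.abcDir y i ^ 2 : ℤ) : ℝ) = ∑ i, ((Torus.abcDir y i : ℤ) : ℝ) ^ 2 := by
    push_cast; rfl
  have h' : ((∑ i, Torus.abcDir y i ^ 2 : ℤ) : ℝ) = ((1 : ℤ) : ℝ) := by rw [e, h]; norm_num
  exact_mod_cast h'

/-- The ABC flow is Fourier-supported on the unit sphere: `Û(m) = 0` unless `∑ mᵢ² ≤ 1` (indeed
unless `m ∈ {±eⱼ}`, `Torus.mFourierCoeff_abcFlow`). This is the sharp support the spherical-shell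
adjacency needs (`ShellCouplingSupport.mFourierCoeff_abcFlow_eq_zero` only records `|m|_∞ ≤ 1`). -/
theorem mFourierCoeff_abcFlow_eq_zero_of_sum_sq (A B C : ℝ) {m : Fin 3 → ℤ}
    (hm : ¬ ∑ i, m i ^ 2 ≤ 1) : mFourierCoeff (complexify ∘ Torus.abcFlow A B C) m = 0 := by
  rw [Torus.mFourierCoeff_abcFlow, if_neg]
  intro hmem
  obtain ⟨y, rfl⟩ := Torus.mem_abcFreq.mp hmem
  exact hm (sum_sq_abcDir y).le

/-- **S3 (spherical) for the transport term.** For `U = Torus.abcFlow A B C` and a smooth real field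
`w` on `𝕋³` whose Fourier coefficients vanish off the spherical shell `s ≥ 1`
(`s² ≤ |m|² < (s+1)²`), the Fourier coefficients of `(U·∇)w` vanish at every `k` outside the window
`{(s−1)² ≤ |k|² < (s+2)²}`. -/
theorem mFourierCoeff_convect_abcFlow_sph_eq_zero (A B C : ℝ)
    {w : UnitAddTorus (Fin 3) → EuclideanSpace ℝ (Fin 3)} (hw : IsSmooth w) {s : ℤ} (hs : 1 ≤ s)
    (hsupp : ∀ m, (¬ (s ^ 2 ≤ ∑ i, m i ^ 2 ∧ ∑ i, m i ^ 2 < (s + 1) ^ 2)) →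
      mFourierCoeff (complexify ∘ w) m = 0)
    {k : Fin 3 → ℤ} (hk : ¬ ((s - 1) ^ 2 ≤ ∑ i, k i ^ 2 ∧ ∑ i, k i ^ 2 < (s + 2) ^ 2)) :
    mFourierCoeff (complexify ∘ Torus.convect (Torus.abcFlow A B C) w) k = 0 := by
  rw [mFourierCoeff_convect_real (Torus.isSmooth_abcFlow A B C) hw k]
  ext p
  rw [PiLp.toLp_apply]
  refine (transportSym_eq_zero_of_sph_host (s := s) hs ?_ ?_ hk).trans (by simp)
  · intro j q hq; rw [mFourierCoeff_abcFlow_eq_zero_of_sum_sq A B C hq]; rfl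
  · intro m hm; rw [hsupp m hm]; rfl

/-- **S3 (spherical) for the stretching term.** Same hypotheses: the Fourier coefficients of
`(w·∇)U` vanish at every `k` outside the window. -/
theorem mFourierCoeff_convect_abcFlow_sph_eq_zero' (A B C : ℝ)
    {w : UnitAddTorus (Fin 3) → EuclideanSpace ℝ (Fin 3)} (hw : IsSmooth w) {s : ℤ} (hs : 1 ≤ s)
    (hsupp : ∀ m, (¬ (s ^ 2 ≤ ∑ i, m i ^ 2 ∧ ∑ i, m i ^ 2 < (s + 1) ^ 2)) →
      mFourierCoeff (complexify ∘ w) m = 0)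
    {k : Fin 3 → ℤ} (hk : ¬ ((s - 1) ^ 2 ≤ ∑ i, k i ^ 2 ∧ ∑ i, k i ^ 2 < (s + 2) ^ 2)) :
    mFourierCoeff (complexify ∘ Torus.convect w (Torus.abcFlow A B C)) k = 0 := by
  rw [mFourierCoeff_convect_real hw (Torus.isSmooth_abcFlow A B C) k]
  ext p
  rw [PiLp.toLp_apply]
  refine (transportSym_eq_zero_of_sph_coeff (s := s) hs ?_ ?_ hk).trans (by simp)
  · intro j m hm; rw [hsupp m hm]; rfl
  · intro q hq; rw [mFourierCoeff_abcFlow_eq_zero_of_sum_sq A B C hq]; rfl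

end Summit.NavierStokesRegularity.FluidComputer.SphShellAdjacency
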